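import Literature.AnabelianGeometry.EtaleTheta.SettingModelTateThetaCusp
import Literature.AnabelianGeometry.EtaleTheta.SettingModelTateCuspGroupLevel
import Literature.AnabelianGeometry.EtaleTheta.SettingBridge
import HarnessLib

/-!
# The NAMED cusped STAGE-2 root `ThetaSetting.modelχq′ p i j hj` (abc-iut-w5-d029's F5qc, «Tate shear» with a cusp): its
# parameter bundle `OncePuncturedData` is INHABITED with no binder; the bridge to `OncePuncturedTemperedGroup ℚ_p` (proof-only)

Mochizuki, *The étale theta function …*, Publ. RIMS **45** (2009) [EtTh], §1, PRIMS pp. 237–239 [cite: MochizukiEtTh2009, §1 p.13];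
*Semi-graphs of anabelioids* [SemiAnbd], Ex. 3.10 pp. 43–45 [cite: MochizukiSemiAnbd2006, Ex 3.10 p.45].  abc-iut cell, seat
abc-iut-w5-d111 (gen 4); R78 cluster STAGE 2 (S2), F5qc consumer side — the twin of this seat's
`SettingModelChiThetaCuspOncePunctured` (p436890) at stage 2.  PROOF-ONLY (0 definitions).  Over abc-iut-w5-d029's
`SettingModelTateThetaCusp` (`ThetaSetting.modelχq′ p i j hj` = abc-iut-L2-t5's F5q record transcribed over the cusped carrier
`curveχq′ p i j`, with (P1)–(P4), the guard and `hYcl` as lemmas) and this seat's `SettingModelTateCuspGroupLevel` (p434858: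
the η′ bundle at `curveχq′`):

* **`nonempty_oncePuncturedData_modelχq'`** — `Nonempty (ThetaSetting.modelχq′ p i j hj).OncePuncturedData`, every field a
  theorem ((P1) `ker_augHat_modelχq'`, (P2) `exists_isCusp_modelχq'`, (P3) `decomp_modelχq'_le_ker_toZ`, (P4)
  `map_aug_decomp_modelχq'`, (P5) `modelχq'_isEtThOrigin` — abc-iut-w5-d029's; the `GroupLevelData` — this seat's
  `nonempty_groupLevelData_curveχq'_holds`); consumers binding `(e : (modelχq′ …).OncePuncturedData)` take `.some`;
* `modelχq'_root_package` — guard ∧ `hYcl` ∧ `aug` open ∧ bundle, for every `(i, j)` with `j` even;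
* **`exists_oncePuncturedTemperedGroup_modelχq'`**, `cuspDecomp_toOncePuncturedTemperedGroup_modelχq'` — through abc-iut-L2's bridge:
  an `OncePuncturedTemperedGroup ℚ_p` with `Π = Γ ⋊_{actχq} G_{ℚ_p}` (the AFFINE «Tate shear» action), `zQuot = toZ`, cusp family
  = the `Π^tp_X`-conjugacy class of `b^Ẑ ⋊ G_{ℚ_p}` — a NON-trivial torsor by this seat's `not_normal_cuspDecompχq` (p436447).
HONEST LABEL: semi-synthetic model — consistency evidence only; nothing of [EtTh]/[SemiAnbd] asserted; no side taken on
[IUTchIII] Cor. 3.12.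
-/

noncomputable section

namespace Literature.AnabelianGeometry.EtaleTheta.SettingModel

open Literature.AnabelianGeometry.SemiGraphs Literature.AlgebraicGeometry.Frobenioids _root_.Topology

variable (p : ℕ) [Fact p.Prime] (i j : ℤ) (hj : Even j)

/-- **`OncePuncturedData` of the named cusped stage-2 root `ThetaSetting.modelχq′ p i j hj` is inhabited — no binder.**
[cite: MochizukiEtTh2009, §1 p.13] -/
theorem nonempty_oncePuncturedData_modelχq' : Nonempty (ThetaSetting.modelχq' p i j hj).OncePuncturedData :=
  ⟨{ toGroupLevelData := (nonempty_groupLevelData_curveχq'_holds p i j).some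
     ker_augHat := ker_augHat_modelχq' p i j hj
     exists_cusp := exists_isCusp_modelχq' p i j hj
     decomp_le_ker_toZ := fun x _ => decomp_modelχq'_le_ker_toZ p i j hj x
     map_aug_decomp := fun x _ => map_aug_decomp_modelχq' p i j hj x
     origin := ThetaSetting.modelχq'_isEtThOrigin p i j hj }⟩

/-- The full root package at the named stage-2 record: guard, `hYcl`, `aug` open, and the bundle.
[cite: MochizukiEtTh2009, §1 p.13] -/
theorem modelχq'_root_package :
    (ThetaSetting.modelχq' p i j hj).IsEtThOrigin ∧
      ((ThetaSetting.modelχq' p i j hj).DtpY.map (ThetaSetting.modelχq' p i j hj).toHat.toMonoidHom).topologicalClosure ≤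
        (ThetaSetting.modelχq' p i j hj).DtpY.map (ThetaSetting.modelχq' p i j hj).toHat.toMonoidHom ⊔
          (⁅⁅(ThetaSetting.modelχq' p i j hj).DeltaHat, (ThetaSetting.modelχq' p i j hj).DeltaHat⁆,
            (ThetaSetting.modelχq' p i j hj).DeltaHat⁆).topologicalClosure ∧
      IsOpenMap (ThetaSetting.modelχq' p i j hj).aug ∧ Nonempty (ThetaSetting.modelχq' p i j hj).OncePuncturedData :=
  ⟨ThetaSetting.modelχq'_isEtThOrigin p i j hj, hYcl_modelχq' p i j hj, isOpenMap_aug_modelχq' p i j hj,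
    nonempty_oncePuncturedData_modelχq' p i j hj⟩

/-- **`OncePuncturedTemperedGroup ℚ_p` from the named cusped stage-2 root** (abc-iut-L2's bridge
`ThetaSetting.toOncePuncturedTemperedGroup`): `Π = Π^tp_X = Γ ⋊_{actχq} G_{ℚ_p}` with the affine «Tate shear» action.
[cite: MochizukiEtTh2009, §1 pp.237-239] -/
theorem exists_oncePuncturedTemperedGroup_modelχq' :
    ∃ T : OncePuncturedTemperedGroup (ThetaSetting.modelχq' p i j hj).K, T.Pi = (ThetaSetting.modelχq' p i j hj).PiTemp :=
  ⟨(ThetaSetting.modelχq' p i j hj).toOncePuncturedTemperedGroup (nonempty_oncePuncturedData_modelχq' p i j hj).some, rfl⟩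

/-- … whose cusp family is `modelχq′`'s `cuspDecompFamily` (the conjugates of `b^Ẑ ⋊ G_{ℚ_p}`, a non-trivial torsor by
`not_normal_cuspDecompχq`). [cite: MochizukiEtTh2009, §1 pp.237-239] -/
theorem cuspDecomp_toOncePuncturedTemperedGroup_modelχq' :
    ((ThetaSetting.modelχq' p i j hj).toOncePuncturedTemperedGroup
        (nonempty_oncePuncturedData_modelχq' p i j hj).some).cuspDecomp =
      (ThetaSetting.modelχq' p i j hj).cuspDecompFamily :=
  rfl

end Literature.AnabelianGeometry.EtaleTheta.SettingModel

end
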